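import Summits.AtomisticToContinuum.BoseEinsteinCondensation.Theorems.BECStronglyRayleighLatticeCoherenceAssembly
import Summits.AtomisticToContinuum.BoseEinsteinCondensation.Theorems.BECStronglyRayleighPairKernelSumRule
import Summits.AtomisticToContinuum.BoseEinsteinCondensation.Theorems.BECStronglyRayleighStableImpliesPairCoherence
import Summits.AtomisticToContinuum.BoseEinsteinCondensation.Theorems.BECStronglyRayleighGroundStateStability
import HarnessLib

/-!
# The lossless split of the crux `InsertionFieldDelocalisation` (K1, stmt-AtomisticToContinuum-9673)
# into sector BEC and pair-kernel hub-freeness (crux-strategist, route `BECStronglyRayleigh`)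

Write, for an admissible datum `(L, N, ψ)` of the crux (a nonzero entrywise-nonnegative ground vector
of the sector `N - L³/2` of `xyTorus 3 L 1`, `L ≥ 2`, `2 ≤ N ≤ L³/2`), `B = ‖ψ‖²`,
`Q = ‖Ŝ⁻_tot ψ‖²`, `ΣL = Σ_T K1lhs(r^T)` and `ΣR = Σ_T K1rhs(r^T) = Σ_T ‖r^T‖²` (sums over the
`(N-2)`-subsets `T`, `r^T` the two-particle insertion field). The crux is `L³·ΣL ≤ M·ΣR`, and the
landed supports give `ΣR = (N-1)·Q` (`PairKernelSumRule_proof` + `re_norm_lower_eq_pairSum`) and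
`N(N-1)·B ≤ ΣL` (Theorem S `GroundStateStability_proof` + `StableImpliesPairCoherence_proof`).
Hence the crux number `L³ΣL/ΣR` factors EXACTLY as `coh / f₀` with `coh = ΣL/(N(N-1)B) ≥ 1` and
`f₀ = Q/(N L³ B) ≤ 3/2` (a Tóth-type ceiling `Q ≤ (N+1)L³B`, `toth_ceiling`, by AM–GM on the pair
sum), and the crux is EQUIVALENT to the conjunction of

* `UniformSectorBEC` — lattice BEC of hard-core bosons in EVERY sector `2 ≤ N ≤ L³/2` of EVERY
  torus `L ≥ 2`: `c·N·L³·‖ψ‖² ≤ ‖Ŝ⁻_tot ψ‖²` (the hypothesis shape of the landed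
  `SectorLadder.stub_transfer`, which turns it into the route target `KineticLatticeBEC`; this is
  the Lieb–Seiringer–Solovej–Yngvason Ch. 11 open problem "BEC at fillings ≠ ½", and its `N/L³ → 0`
  corner is the lattice twin of the conjunct `BoseEinsteinCondensation`);
* `PairCoherenceCeiling` — the Brändén–Huh/Lorentzian lower bound `N(N-1)‖ψ‖² ≤ Σ_T K1lhs(r^T)` is
  sharp up to a constant: `Σ_T K1lhs(r^T) ≤ C·N(N-1)·‖ψ‖²` ("hub-freeness" of the conditional pair
  kernels on average; it holds with `C = 2` for flat AND for block-localised flat kernels, fails for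
  star kernels, so it is NOT a delocalisation statement).

Theorems: `InsertionFieldDelocalisation_of_subs : UniformSectorBEC → PairCoherenceCeiling →
InsertionFieldDelocalisation` (constant `max C 0 / c`), the converses
`uniformSectorBEC_of_insertionFieldDelocalisation` (`c = 1/max M 1`) and
`pairCoherenceCeiling_of_insertionFieldDelocalisation` (`C = 3·max M 0 / 2`), and the `iff`.
Everything is finite-dimensional bookkeeping on top of landed theorems; no new analytic input.
-/

noncomputable section

namespace Summit.AtomisticToContinuum.BoseEinsteinCondensation.Cruxes.InsertionFieldDelocalisation.Split

open scoped BigOperators ComplexOrder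
open Literature.MathematicalPhysics.QuantumLattice Literature.Probability.LatticeModels Matrix Complex Finset
open Summit.AtomisticToContinuum.BoseEinsteinCondensation.Theses.BECStronglyRayleigh
open Summit.AtomisticToContinuum.BoseEinsteinCondensation.Theorems.InsertionFieldDelocalisation.Negative
open Summit.AtomisticToContinuum.BoseEinsteinCondensation.Theorems.LatticeCoherence

/-- **Sub-statement 1 — uniform sector BEC.** There is `c > 0` such that for every `L ≥ 2`, every
`2 ≤ N ≤ L³/2` and every nonzero entrywise-nonnegative ground vector `ψ` of the sector `N - L³/2` of
`xyTorus 3 L 1`: `c · N · L³ · ‖ψ‖² ≤ ‖Ŝ⁻_tot ψ‖²` (`Ŝ⁻_tot = totalSpin 1 0 - I • totalSpin 1 1`), i.e.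
`⟨Ŝ⁺_totŜ⁻_tot⟩_ψ ≥ c N L³`: hard-core lattice BEC at every filling `≤ ½`, in sector (Perron) form. A statement (conjecture-grade sub-crux candidate), not a fact. -/
def UniformSectorBEC : Prop :=
  ∃ c : ℝ, 0 < c ∧ ∀ (L : ℕ) [NeZero L], 2 ≤ L → ∀ N : ℕ, 2 ≤ N → 2 * N ≤ L ^ 3 →
    ∀ ψ : TensorIndex (TorusSite 3 L) 2 → ℂ,
      ψ ∈ spinZSector 1 ((N : ℝ) - (L : ℝ) ^ 3 / 2) → ψ ≠ 0 →
      (xyTorus 3 L 1).mulVec ψ =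
        ((lowestEnergyInSector 1 (xyTorus 3 L 1) ((N : ℝ) - (L : ℝ) ^ 3 / 2) : ℝ) : ℂ) • ψ →
      (∀ σ, 0 ≤ (ψ σ).re ∧ (ψ σ).im = 0) →
      c * N * (L : ℝ) ^ 3 * (star ψ ⬝ᵥ ψ).re ≤
        (star ((totalSpin 1 0 - I • totalSpin 1 1 : Op (TorusSite 3 L) 2) *ᵥ ψ) ⬝ᵥ
          ((totalSpin 1 0 - I • totalSpin 1 1 : Op (TorusSite 3 L) 2) *ᵥ ψ)).re

/-- **Sub-statement 2 — pair-coherence ceiling (hub-freeness).** There is `C` such that for every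
admissible datum `Σ_{|T|=N-2} K1lhs(r^T) ≤ C · N(N-1) · ‖ψ‖²`, where `K1lhs r = Σr³/Σr + (Σr²)²/(Σr)²`
and `r^T = field ψ T` is the crux's two-particle insertion field: the Lorentzian lower bound of
`StableImpliesPairCoherence` is sharp up to the factor `C`. A statement (conjecture-grade sub-crux candidate), not a fact. -/
def PairCoherenceCeiling : Prop :=
  ∃ C : ℝ, ∀ (L : ℕ) [NeZero L], 2 ≤ L → ∀ N : ℕ, 2 ≤ N → 2 * N ≤ L ^ 3 →
    ∀ ψ : TensorIndex (TorusSite 3 L) 2 → ℂ,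
      ψ ∈ spinZSector 1 ((N : ℝ) - (L : ℝ) ^ 3 / 2) → ψ ≠ 0 →
      (xyTorus 3 L 1).mulVec ψ =
        ((lowestEnergyInSector 1 (xyTorus 3 L 1) ((N : ℝ) - (L : ℝ) ^ 3 / 2) : ℝ) : ℂ) • ψ →
      (∀ σ, 0 ≤ (ψ σ).re ∧ (ψ σ).im = 0) →
      ∑ T ∈ (Finset.univ : Finset (TorusSite 3 L)).powersetCard (N - 2), K1lhs (field ψ T) ≤
        C * N * ((N : ℝ) - 1) * (star ψ ⬝ᵥ ψ).re

/-! ### Bookkeeping for an admissible datum -/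

section Datum

variable {L : ℕ} [NeZero L] {N : ℕ} (ψ : TensorIndex (TorusSite 3 L) 2 → ℂ)

/-- The occupation amplitudes `φ(S) = Re ψ(1_S)` (auxiliary definition). [folklore] -/
def amp (S : Finset (TorusSite 3 L)) : ℝ := (ψ (fun x => if x ∈ S then 0 else 1)).re

omit [NeZero L] in
/-- Bookkeeping. [folklore] -/
theorem amp_def (S : Finset (TorusSite 3 L)) :
    amp ψ S = (ψ (fun x => if x ∈ S then 0 else 1)).re := rfl

/-- The crux's field is the pair-insertion field of `amp ψ` (definitional). [folklore] -/
theorem field_eq (T : Finset (TorusSite 3 L)) (x : TorusSite 3 L) :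
    field ψ T x = ∑ y, (if x ∉ T ∧ y ∉ T ∧ x ≠ y then amp ψ (insert x (insert y T)) else 0) := rfl

variable {ψ}

/-- Sector support: `amp ψ S = 0` unless `|S| = N`. [folklore] -/
theorem amp_eq_zero_of_card_ne (hψsec : ψ ∈ spinZSector 1 ((N : ℝ) - (L : ℝ) ^ 3 / 2))
    (S : Finset (TorusSite 3 L)) (hS : S.card ≠ N) : amp ψ S = 0 := by
  have hcard := Literature.Probability.LatticeModels.card_torusSite 3 L
  rw [amp_def, apply_ind_eq_zero_of_card_ne N (by rw [hcard]; push_cast; ring) hψsec S hS,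
    Complex.zero_re]

/-- `‖ψ‖² = Σ_S amp(S)²`. [folklore] -/
theorem normSq_eq (hnn : ∀ σ, 0 ≤ (ψ σ).re ∧ (ψ σ).im = 0) :
    (star ψ ⬝ᵥ ψ).re = ∑ S : Finset (TorusSite 3 L), amp ψ S ^ 2 :=
  re_norm_eq_sum_sq ψ (fun σ => (hnn σ).2) (amp ψ) (fun _ => rfl)

/-- **The pair-kernel sum rule for the datum**: `Σ_T K1rhs(r^T) = (N-1)·‖Ŝ⁻_tot ψ‖²`. [folklore] -/
theorem sum_K1rhs_eq (hN : 2 ≤ N) (hψsec : ψ ∈ spinZSector 1 ((N : ℝ) - (L : ℝ) ^ 3 / 2))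
    (hnn : ∀ σ, 0 ≤ (ψ σ).re ∧ (ψ σ).im = 0) :
    ∑ T ∈ (Finset.univ : Finset (TorusSite 3 L)).powersetCard (N - 2), K1rhs (field ψ T) =
      ((N : ℝ) - 1) *
        (star ((totalSpin 1 0 - I • totalSpin 1 1 : Op (TorusSite 3 L) 2) *ᵥ ψ) ⬝ᵥ
          ((totalSpin 1 0 - I • totalSpin 1 1 : Op (TorusSite 3 L) 2) *ᵥ ψ)).re := by
  have hsupp : ∀ S : Finset (TorusSite 3 L), S.card ≠ N → amp ψ S = 0 :=
    amp_eq_zero_of_card_ne hψsec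
  have h3 : ∑ T ∈ (Finset.univ : Finset (TorusSite 3 L)).powersetCard (N - 2),
        ∑ x, (∑ y, (if x ∉ T ∧ y ∉ T ∧ x ≠ y then amp ψ (insert x (insert y T)) else 0)) ^ 2 =
      ((N : ℝ) - 1) * ∑ x : TorusSite 3 L, ∑ y : TorusSite 3 L,
        (if x = y then ∑ S : Finset (TorusSite 3 L), (if x ∈ S then amp ψ S ^ 2 else 0)
          else ∑ T ∈ (Finset.univ : Finset (TorusSite 3 L)).powersetCard (N - 1),
            (if x ∉ T ∧ y ∉ T then amp ψ (insert x T) * amp ψ (insert y T) else 0)) :=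
    Summit.AtomisticToContinuum.BoseEinsteinCondensation.Theorems.PairKernelSumRule_proof
      (TorusSite 3 L) N hN (amp ψ) hsupp
  have h4 := re_norm_lower_eq_pairSum N ψ (fun σ => (hnn σ).2) (amp ψ) (fun _ => rfl) hsupp
  rw [h4, ← h3]
  rfl

/-- **Theorem S + Lorentzian glue for the datum**: `N(N-1)·‖ψ‖² ≤ Σ_T K1lhs(r^T)`. [folklore] -/
theorem coherence_floor (hN : 2 ≤ N) (hψsec : ψ ∈ spinZSector 1 ((N : ℝ) - (L : ℝ) ^ 3 / 2))
    (hψ0 : ψ ≠ 0)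
    (hH : (xyTorus 3 L 1).mulVec ψ =
      ((lowestEnergyInSector 1 (xyTorus 3 L 1) ((N : ℝ) - (L : ℝ) ^ 3 / 2) : ℝ) : ℂ) • ψ)
    (hnn : ∀ σ, 0 ≤ (ψ σ).re ∧ (ψ σ).im = 0) :
    (N : ℝ) * ((N : ℝ) - 1) * (star ψ ⬝ᵥ ψ).re ≤
      ∑ T ∈ (Finset.univ : Finset (TorusSite 3 L)).powersetCard (N - 2), K1lhs (field ψ T) := by
  have hreal : ∀ σ, (ψ σ).im = 0 := fun σ => (hnn σ).2
  have hsupp : ∀ S : Finset (TorusSite 3 L), S.card ≠ N → amp ψ S = 0 :=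
    amp_eq_zero_of_card_ne hψsec
  have hφnn : ∀ S, 0 ≤ amp ψ S := fun S => (hnn _).1
  -- Theorem S on the torus graph, `Δ = 0`, `μ = 0`
  have hstab : ∀ z : TorusSite 3 L → ℂ, (∀ x, 0 < (z x).im) →
      (∑ S : Finset (TorusSite 3 L), (amp ψ S : ℂ) * ∏ x ∈ S, z x) ≠ 0 := by
    intro z hz
    have h := Summit.AtomisticToContinuum.BoseEinsteinCondensation.Theorems.GroundStateStability_proof
      (TorusSite 3 L) (torusGraph 3 L) (torusGraph_connected 3 L) 0 (fun _ => 0)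
      (by norm_num) ((N : ℝ) - (L : ℝ) ^ 3 / 2) ψ hψsec hψ0
    simp only [Complex.ofReal_zero, zero_smul, Finset.sum_const_zero, add_zero] at h
    rw [← occPoly_eq ψ hreal (amp ψ) (fun _ => rfl) z]
    exact h hH z hz
  have h1 : (N : ℝ) * ((N : ℝ) - 1) * ∑ S : Finset (TorusSite 3 L), amp ψ S ^ 2 ≤
      ∑ T ∈ (Finset.univ : Finset (TorusSite 3 L)).powersetCard (N - 2),
        ((∑ x, (∑ y, (if x ∉ T ∧ y ∉ T ∧ x ≠ y then amp ψ (insert x (insert y T)) else 0)) ^ 3) /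
            (∑ x, (∑ y, (if x ∉ T ∧ y ∉ T ∧ x ≠ y then amp ψ (insert x (insert y T)) else 0))) +
          (∑ x, (∑ y, (if x ∉ T ∧ y ∉ T ∧ x ≠ y then amp ψ (insert x (insert y T)) else 0)) ^ 2) ^ 2 /
            (∑ x, (∑ y, (if x ∉ T ∧ y ∉ T ∧ x ≠ y then amp ψ (insert x (insert y T)) else 0))) ^ 2) :=
    Summit.AtomisticToContinuum.BoseEinsteinCondensation.Theorems.StableImpliesPairCoherence_proof
      (TorusSite 3 L) N hN (amp ψ) hφnn hsupp hstab
  rw [normSq_eq hnn]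
  exact h1

/-- **Tóth-type ceiling by AM–GM**: `‖Ŝ⁻_tot ψ‖² ≤ (N + 1) · L³ · ‖ψ‖²` for a real vector of the
sector `N - L³/2` (from the pair-sum representation: the diagonal is `≤ L³‖ψ‖²`, each off-diagonal
product is `≤ ½(a² + b²)`, and `Σ_x Σ_{T ∌ x} amp(T ∪ {x})² = N · ‖ψ‖²` by double counting). [folklore] -/
theorem toth_ceiling (hN : 2 ≤ N) (hψsec : ψ ∈ spinZSector 1 ((N : ℝ) - (L : ℝ) ^ 3 / 2))
    (hnn : ∀ σ, 0 ≤ (ψ σ).re ∧ (ψ σ).im = 0) :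
    (star ((totalSpin 1 0 - I • totalSpin 1 1 : Op (TorusSite 3 L) 2) *ᵥ ψ) ⬝ᵥ
        ((totalSpin 1 0 - I • totalSpin 1 1 : Op (TorusSite 3 L) 2) *ᵥ ψ)).re ≤
      ((N : ℝ) + 1) * (L : ℝ) ^ 3 * (star ψ ⬝ᵥ ψ).re := by
  classical
  have hreal : ∀ σ, (ψ σ).im = 0 := fun σ => (hnn σ).2
  have hsupp : ∀ S : Finset (TorusSite 3 L), S.card ≠ N → amp ψ S = 0 :=
    amp_eq_zero_of_card_ne hψsec
  set φ := amp ψ with hφ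
  set B : ℝ := ∑ S : Finset (TorusSite 3 L), φ S ^ 2 with hB
  have hBnn : 0 ≤ B := Finset.sum_nonneg fun S _ => sq_nonneg _
  -- the one-point square sum `U x = Σ_{|T| = N-1, x ∉ T} φ(T ∪ {x})²`
  set U : TorusSite 3 L → ℝ := fun x =>
    ∑ T ∈ (Finset.univ : Finset (TorusSite 3 L)).powersetCard (N - 1),
      (if x ∉ T then φ (insert x T) ^ 2 else 0) with hU
  have hUnn : ∀ x, 0 ≤ U x := fun x =>
    Finset.sum_nonneg fun T _ => by split_ifs <;> positivity
  -- double counting: `Σ_x U x = N · Σ_{|S| = N} φ(S)² ≤ N · B`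
  have hUsum : ∑ x, U x ≤ (N : ℝ) * B := by
    have hN' : N - 1 + 1 = N := by omega
    have hx : ∀ x : TorusSite 3 L, U x =
        ∑ S ∈ (Finset.univ : Finset (TorusSite 3 L)).powersetCard N,
          (if x ∈ S then φ S ^ 2 else 0) := by
      intro x
      have := Summit.AtomisticToContinuum.BoseEinsteinCondensation.Theorems.sum_powersetCard_ite_notMem
        (N - 1) x (fun S : Finset (TorusSite 3 L) => φ S ^ 2)
      rw [hN'] at this
      exact this
    calc ∑ x, U x
        = ∑ x, ∑ S ∈ (Finset.univ : Finset (TorusSite 3 L)).powersetCard N,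
            (if x ∈ S then φ S ^ 2 else 0) := Finset.sum_congr rfl fun x _ => hx x
      _ = ∑ S ∈ (Finset.univ : Finset (TorusSite 3 L)).powersetCard N,
            ∑ x, (if x ∈ S then φ S ^ 2 else 0) := Finset.sum_comm
      _ = ∑ S ∈ (Finset.univ : Finset (TorusSite 3 L)).powersetCard N, (N : ℝ) * φ S ^ 2 := by
          refine Finset.sum_congr rfl fun S hS => ?_
          rw [Finset.mem_powersetCard_univ] at hS
          rw [← Finset.sum_filter, Finset.sum_const, nsmul_eq_mul]
          congr 1
          have : (Finset.univ.filter fun x => x ∈ S) = S := by ext x; simp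
          rw [this, hS]
      _ = (N : ℝ) * ∑ S ∈ (Finset.univ : Finset (TorusSite 3 L)).powersetCard N, φ S ^ 2 := by
          rw [Finset.mul_sum]
      _ ≤ (N : ℝ) * B := by
          refine mul_le_mul_of_nonneg_left ?_ (Nat.cast_nonneg N)
          exact Finset.sum_le_sum_of_subset_of_nonneg (Finset.subset_univ _)
            (fun S _ _ => sq_nonneg _)
  -- the pair-sum representation of `‖Ŝ⁻ψ‖²`
  rw [re_norm_lower_eq_pairSum N ψ hreal φ (fun _ => rfl) hsupp, re_norm_eq_sum_sq ψ hreal φ (fun _ => rfl)]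
  -- termwise bound: diagonal `≤ B`, off-diagonal `≤ ½ (U x + U y)`
  have hterm : ∀ x y : TorusSite 3 L,
      (if x = y then ∑ S : Finset (TorusSite 3 L), (if x ∈ S then φ S ^ 2 else 0)
        else ∑ T ∈ (Finset.univ : Finset (TorusSite 3 L)).powersetCard (N - 1),
          (if x ∉ T ∧ y ∉ T then φ (insert x T) * φ (insert y T) else 0)) ≤
        (if x = y then B else 0) + (U x + U y) / 2 := by
    intro x y
    by_cases hxy : x = y
    · rw [if_pos hxy, if_pos hxy]
      have h1 : ∑ S : Finset (TorusSite 3 L), (if x ∈ S then φ S ^ 2 else 0) ≤ B :=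
        Finset.sum_le_sum fun S _ => by split_ifs <;> nlinarith [sq_nonneg (φ S)]
      have h2 : 0 ≤ (U x + U y) / 2 := by linarith [hUnn x, hUnn y]
      linarith
    · rw [if_neg hxy, if_neg hxy, zero_add]
      have h1 : ∑ T ∈ (Finset.univ : Finset (TorusSite 3 L)).powersetCard (N - 1),
            (if x ∉ T ∧ y ∉ T then φ (insert x T) * φ (insert y T) else 0) ≤
          ∑ T ∈ (Finset.univ : Finset (TorusSite 3 L)).powersetCard (N - 1),
            ((if x ∉ T then φ (insert x T) ^ 2 else 0) + (if y ∉ T then φ (insert y T) ^ 2 else 0)) / 2 := by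
        refine Finset.sum_le_sum fun T _ => ?_
        by_cases h : x ∉ T ∧ y ∉ T
        · rw [if_pos h, if_pos h.1, if_pos h.2]
          nlinarith [sq_nonneg (φ (insert x T) - φ (insert y T))]
        · rw [if_neg h]
          have ha : 0 ≤ (if x ∉ T then φ (insert x T) ^ 2 else 0) := by split_ifs <;> positivity
          have hb : 0 ≤ (if y ∉ T then φ (insert y T) ^ 2 else 0) := by split_ifs <;> positivity
          linarith
      refine h1.trans (le_of_eq ?_)
      rw [← Finset.sum_div, Finset.sum_add_distrib]
  have hcard : (Finset.univ : Finset (TorusSite 3 L)).card = L ^ 3 := by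
    rw [Finset.card_univ, Literature.Probability.LatticeModels.card_torusSite]
  calc ∑ x : TorusSite 3 L, ∑ y : TorusSite 3 L,
        (if x = y then ∑ S : Finset (TorusSite 3 L), (if x ∈ S then φ S ^ 2 else 0)
          else ∑ T ∈ (Finset.univ : Finset (TorusSite 3 L)).powersetCard (N - 1),
            (if x ∉ T ∧ y ∉ T then φ (insert x T) * φ (insert y T) else 0))
      ≤ ∑ x : TorusSite 3 L, ∑ y : TorusSite 3 L, ((if x = y then B else 0) + (U x + U y) / 2) :=
        Finset.sum_le_sum fun x _ => Finset.sum_le_sum fun y _ => hterm x y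
    _ = ∑ x : TorusSite 3 L, (B + ((L : ℝ) ^ 3 * U x + ∑ y, U y) / 2) := by
        refine Finset.sum_congr rfl fun x _ => ?_
        rw [Finset.sum_add_distrib, Finset.sum_ite_eq Finset.univ x (fun _ => B), if_pos (Finset.mem_univ x)]
        congr 1
        rw [← Finset.sum_div, Finset.sum_add_distrib, Finset.sum_const, nsmul_eq_mul, hcard]
        push_cast
        ring
    _ = (L : ℝ) ^ 3 * B + (L : ℝ) ^ 3 * ∑ x, U x := by
        rw [Finset.sum_add_distrib, Finset.sum_const, nsmul_eq_mul, hcard, ← Finset.sum_div,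
          Finset.sum_add_distrib, Finset.sum_const, nsmul_eq_mul, hcard, ← Finset.mul_sum]
        push_cast
        ring
    _ ≤ (L : ℝ) ^ 3 * B + (L : ℝ) ^ 3 * ((N : ℝ) * B) := by
        have hL3 : (0 : ℝ) ≤ (L : ℝ) ^ 3 := by positivity
        nlinarith [mul_le_mul_of_nonneg_left hUsum hL3]
    _ = ((N : ℝ) + 1) * (L : ℝ) ^ 3 * B := by ring

end Datum

/-! ### The split and its converses -/

/-- **`InsertionFieldDelocalisation_of_subs`** — the decomposition glue: uniform sector BEC and the
pair-coherence ceiling imply the crux, with `M = max C 0 / c`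
(`L³·ΣL ≤ L³·C·N(N-1)‖ψ‖² ≤ (C/c)·(N-1)·‖Ŝ⁻ψ‖² = (C/c)·ΣR`). [folklore] -/
theorem InsertionFieldDelocalisation_of_subs (h₁ : UniformSectorBEC) (h₂ : PairCoherenceCeiling) :
    InsertionFieldDelocalisation := by
  obtain ⟨c, hc, h₁⟩ := h₁
  obtain ⟨C, h₂⟩ := h₂
  rw [insertionFieldDelocalisation_iff]
  refine ⟨max C 0 / c, ?_⟩
  intro L _ hL N hN hNL ψ hψsec hψ0 hH hnn
  have hbec := h₁ L hL N hN hNL ψ hψsec hψ0 hH hnn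
  have hpcc := h₂ L hL N hN hNL ψ hψsec hψ0 hH hnn
  have hsum := sum_K1rhs_eq (ψ := ψ) hN hψsec hnn
  set Q : ℝ := (star ((totalSpin 1 0 - I • totalSpin 1 1 : Op (TorusSite 3 L) 2) *ᵥ ψ) ⬝ᵥ
    ((totalSpin 1 0 - I • totalSpin 1 1 : Op (TorusSite 3 L) 2) *ᵥ ψ)).re with hQ
  set B : ℝ := (star ψ ⬝ᵥ ψ).re with hB
  have hBnn : 0 ≤ B := EigenvalueContinuation.re_star_dotProduct_self_nonneg _
  have hN1 : (0 : ℝ) ≤ (N : ℝ) - 1 := by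
    have : (2 : ℝ) ≤ N := by exact_mod_cast hN
    linarith
  have hK : (0 : ℝ) ≤ max C 0 / c := div_nonneg (le_max_right _ _) hc.le
  have hpcc' : ∑ T ∈ (Finset.univ : Finset (TorusSite 3 L)).powersetCard (N - 2), K1lhs (field ψ T) ≤
      max C 0 * N * ((N : ℝ) - 1) * B := by
    refine hpcc.trans ?_
    have h : 0 ≤ (N : ℝ) * ((N : ℝ) - 1) * B := by positivity
    nlinarith [le_max_left C 0, h]
  show (L : ℝ) ^ 3 * ∑ T ∈ (Finset.univ : Finset (TorusSite 3 L)).powersetCard (N - 2),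
      K1lhs (field ψ T) ≤
    max C 0 / c * ∑ T ∈ (Finset.univ : Finset (TorusSite 3 L)).powersetCard (N - 2), K1rhs (field ψ T)
  rw [hsum]
  calc (L : ℝ) ^ 3 * ∑ T ∈ (Finset.univ : Finset (TorusSite 3 L)).powersetCard (N - 2), K1lhs (field ψ T)
      ≤ (L : ℝ) ^ 3 * (max C 0 * N * ((N : ℝ) - 1) * B) :=
        mul_le_mul_of_nonneg_left hpcc' (by positivity)
    _ = max C 0 / c * (((N : ℝ) - 1) * (c * N * (L : ℝ) ^ 3 * B)) := by
        field_simp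
    _ ≤ max C 0 / c * (((N : ℝ) - 1) * Q) := by
        refine mul_le_mul_of_nonneg_left ?_ hK
        exact mul_le_mul_of_nonneg_left hbec hN1

/-- **Converse 1**: the crux implies uniform sector BEC with `c = 1/max M 1`
(`N(N-1)·L³‖ψ‖² ≤ L³·ΣL ≤ M·ΣR = M(N-1)·‖Ŝ⁻ψ‖²`). [folklore] -/
theorem uniformSectorBEC_of_insertionFieldDelocalisation (hI : InsertionFieldDelocalisation) :
    UniformSectorBEC := by
  rw [insertionFieldDelocalisation_iff] at hI
  obtain ⟨M, hM⟩ := hI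
  refine ⟨1 / max M 1, by positivity, ?_⟩
  intro L _ hL N hN hNL ψ hψsec hψ0 hH hnn
  have hK1 : (L : ℝ) ^ 3 * ∑ T ∈ (Finset.univ : Finset (TorusSite 3 L)).powersetCard (N - 2),
      K1lhs (field ψ T) ≤
    M * ∑ T ∈ (Finset.univ : Finset (TorusSite 3 L)).powersetCard (N - 2), K1rhs (field ψ T) :=
    hM L hL N hN hNL ψ hψsec hψ0 hH hnn
  have hfloor := coherence_floor (ψ := ψ) hN hψsec hψ0 hH hnn
  have hsum := sum_K1rhs_eq (ψ := ψ) hN hψsec hnn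
  set Q : ℝ := (star ((totalSpin 1 0 - I • totalSpin 1 1 : Op (TorusSite 3 L) 2) *ᵥ ψ) ⬝ᵥ
    ((totalSpin 1 0 - I • totalSpin 1 1 : Op (TorusSite 3 L) 2) *ᵥ ψ)).re with hQ
  set B : ℝ := (star ψ ⬝ᵥ ψ).re with hB
  have hQnn : 0 ≤ Q := EigenvalueContinuation.re_star_dotProduct_self_nonneg _
  have hBnn : 0 ≤ B := EigenvalueContinuation.re_star_dotProduct_self_nonneg _
  have hpos : (0 : ℝ) < (N : ℝ) - 1 := by
    have : (2 : ℝ) ≤ N := by exact_mod_cast hN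
    linarith
  have hmax1 : (1 : ℝ) ≤ max M 1 := le_max_right _ _
  have hmaxM : M ≤ max M 1 := le_max_left _ _
  have hmaxpos : 0 < max M 1 := lt_of_lt_of_le one_pos hmax1
  rw [hsum] at hK1
  -- `(N-1) · (N L³ B) ≤ (N-1) · (M Q)`
  have hA : ((N : ℝ) - 1) * ((N : ℝ) * (L : ℝ) ^ 3 * B) ≤ ((N : ℝ) - 1) * (max M 1 * Q) := by
    calc ((N : ℝ) - 1) * ((N : ℝ) * (L : ℝ) ^ 3 * B)
        = (L : ℝ) ^ 3 * ((N : ℝ) * ((N : ℝ) - 1) * B) := by ring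
      _ ≤ (L : ℝ) ^ 3 * ∑ T ∈ (Finset.univ : Finset (TorusSite 3 L)).powersetCard (N - 2),
            K1lhs (field ψ T) := mul_le_mul_of_nonneg_left hfloor (by positivity)
      _ ≤ M * (((N : ℝ) - 1) * Q) := hK1
      _ ≤ max M 1 * (((N : ℝ) - 1) * Q) :=
          mul_le_mul_of_nonneg_right hmaxM (mul_nonneg hpos.le hQnn)
      _ = ((N : ℝ) - 1) * (max M 1 * Q) := by ring
  have hB' : (N : ℝ) * (L : ℝ) ^ 3 * B ≤ max M 1 * Q := le_of_mul_le_mul_left hA hpos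
  calc 1 / max M 1 * N * (L : ℝ) ^ 3 * B = ((N : ℝ) * (L : ℝ) ^ 3 * B) / max M 1 := by ring
    _ ≤ (max M 1 * Q) / max M 1 := div_le_div_of_nonneg_right hB' hmaxpos.le
    _ = Q := by field_simp

/-- **Converse 2**: the crux implies the pair-coherence ceiling with `C = 3 · max M 0 / 2`
(`L³·ΣL ≤ M·ΣR = M(N-1)‖Ŝ⁻ψ‖² ≤ M(N-1)(N+1)L³‖ψ‖²` by `toth_ceiling`, and `N + 1 ≤ 3N/2`). [folklore] -/
theorem pairCoherenceCeiling_of_insertionFieldDelocalisation (hI : InsertionFieldDelocalisation) :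
    PairCoherenceCeiling := by
  rw [insertionFieldDelocalisation_iff] at hI
  obtain ⟨M, hM⟩ := hI
  refine ⟨3 * max M 0 / 2, ?_⟩
  intro L _ hL N hN hNL ψ hψsec hψ0 hH hnn
  have hK1 : (L : ℝ) ^ 3 * ∑ T ∈ (Finset.univ : Finset (TorusSite 3 L)).powersetCard (N - 2),
      K1lhs (field ψ T) ≤
    M * ∑ T ∈ (Finset.univ : Finset (TorusSite 3 L)).powersetCard (N - 2), K1rhs (field ψ T) :=
    hM L hL N hN hNL ψ hψsec hψ0 hH hnn
  have hsum := sum_K1rhs_eq (ψ := ψ) hN hψsec hnn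
  have htoth := toth_ceiling (ψ := ψ) (N := N) hN hψsec hnn
  set Q : ℝ := (star ((totalSpin 1 0 - I • totalSpin 1 1 : Op (TorusSite 3 L) 2) *ᵥ ψ) ⬝ᵥ
    ((totalSpin 1 0 - I • totalSpin 1 1 : Op (TorusSite 3 L) 2) *ᵥ ψ)).re with hQ
  set B : ℝ := (star ψ ⬝ᵥ ψ).re with hB
  set SL : ℝ := ∑ T ∈ (Finset.univ : Finset (TorusSite 3 L)).powersetCard (N - 2),
    K1lhs (field ψ T) with hSL
  have hQnn : 0 ≤ Q := EigenvalueContinuation.re_star_dotProduct_self_nonneg _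
  have hBnn : 0 ≤ B := EigenvalueContinuation.re_star_dotProduct_self_nonneg _
  have hN1 : (0 : ℝ) ≤ (N : ℝ) - 1 := by
    have : (2 : ℝ) ≤ N := by exact_mod_cast hN
    linarith
  have hN2 : (2 : ℝ) ≤ N := by exact_mod_cast hN
  have hL3 : (0 : ℝ) < (L : ℝ) ^ 3 := by
    have : (2 : ℝ) ≤ L := by exact_mod_cast hL
    positivity
  have hRnn : 0 ≤ ∑ T ∈ (Finset.univ : Finset (TorusSite 3 L)).powersetCard (N - 2), K1rhs (field ψ T) := by
    rw [hsum]; exact mul_nonneg hN1 hQnn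
  -- replace `M` by `max M 0`
  have hK1' : (L : ℝ) ^ 3 * SL ≤ max M 0 * (((N : ℝ) - 1) * Q) := by
    rw [← hsum]
    exact hK1.trans (mul_le_mul_of_nonneg_right (le_max_left _ _) hRnn)
  have hM0 : 0 ≤ max M 0 := le_max_right _ _
  -- chain with the Tóth ceiling
  have hchain : (L : ℝ) ^ 3 * SL ≤ (L : ℝ) ^ 3 * (3 * max M 0 / 2 * N * ((N : ℝ) - 1) * B) := by
    calc (L : ℝ) ^ 3 * SL ≤ max M 0 * (((N : ℝ) - 1) * Q) := hK1'
      _ ≤ max M 0 * (((N : ℝ) - 1) * (((N : ℝ) + 1) * (L : ℝ) ^ 3 * B)) :=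
          mul_le_mul_of_nonneg_left (mul_le_mul_of_nonneg_left htoth hN1) hM0
      _ ≤ max M 0 * (((N : ℝ) - 1) * ((3 * N / 2) * (L : ℝ) ^ 3 * B)) := by
          have h1 : ((N : ℝ) + 1) * (L : ℝ) ^ 3 * B ≤ (3 * N / 2) * (L : ℝ) ^ 3 * B := by
            have : (N : ℝ) + 1 ≤ 3 * N / 2 := by linarith
            exact mul_le_mul_of_nonneg_right (mul_le_mul_of_nonneg_right this hL3.le) hBnn
          exact mul_le_mul_of_nonneg_left (mul_le_mul_of_nonneg_left h1 hN1) hM0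
      _ = (L : ℝ) ^ 3 * (3 * max M 0 / 2 * N * ((N : ℝ) - 1) * B) := by ring
  exact le_of_mul_le_mul_left hchain hL3

/-- **The lossless split**: `InsertionFieldDelocalisation ↔ UniformSectorBEC ∧ PairCoherenceCeiling`. [folklore] -/
theorem insertionFieldDelocalisation_iff_split :
    InsertionFieldDelocalisation ↔ UniformSectorBEC ∧ PairCoherenceCeiling :=
  ⟨fun h => ⟨uniformSectorBEC_of_insertionFieldDelocalisation h,
    pairCoherenceCeiling_of_insertionFieldDelocalisation h⟩,
    fun h => InsertionFieldDelocalisation_of_subs h.1 h.2⟩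

end Summit.AtomisticToContinuum.BoseEinsteinCondensation.Cruxes.InsertionFieldDelocalisation.Split
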